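import Mathlib

/-!
# `PolycrystalWulffBound`, rung `rung_twinTree` — step 0: SUBTREE WEIGHTS on a recursively indexed tree
# (line `PolyDensity`, crux `stmt-Ventures-19482`)

Route `StickyWulffConstant` of the venture `Summits/Ventures/Crystal3D`, second prover lane (poly-p2,
gen 12).  Pure bookkeeping for the sorted piecewise Brunn–Minkowski engine on a TREE of grains
(`…TwinTreeChimera.lean`): the nodes are `Fin (N+1)` with root `0`; node `i.succ` has the parent `par i`
with `(par i : ℕ) ≤ i` (parents come first).  Given nonnegative node weights `σ` summing to `1` (the
volume fractions of the grains), `exists_subtreeWeights` produces the SUBTREE WEIGHTS `u` —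
`u g = σ g + Σ_{children c of g} u c` — with `0 ≤ u ≤ 1` and `u 0 = 1` (downward recursion on the index;
`u 0 = 1` by double counting: every non-root node is the child of exactly one node).  The engine cuts the
target of node `g` out of its body above the cap height of fraction `u g` along its own axis and below
the cap heights `u c` of its children.
WHAT THIS IS NOT: anything geometric; the crux is not claimed.
-/

namespace Summit.Ventures.Crystal3D.Theorems

open Finset

/-- **Subtree weights.**  On the tree `Fin (N+1)` (root `0`, parent of `i.succ` is `par i ≤ i`), for
nonnegative weights `σ` with `Σ σ = 1` there are `u` with `u g = σ g + Σ_{i : par i = g} u i.succ`,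
`0 ≤ u g ≤ 1` and `u 0 = 1`. -/
theorem exists_subtreeWeights {N : ℕ} (par : Fin N → Fin (N + 1)) (hpar : ∀ i, (par i : ℕ) ≤ i)
    (σ : Fin (N + 1) → ℝ) (hσ0 : ∀ g, 0 ≤ σ g) (hσ1 : ∑ g, σ g = 1) :
    ∃ u : Fin (N + 1) → ℝ,
      (∀ g, u g = σ g + ∑ i ∈ univ.filter (fun i => par i = g), u i.succ) ∧
      (∀ g, 0 ≤ u g) ∧ (∀ g, u g ≤ 1) ∧ u 0 = 1 := by
  classical
  -- downward construction: `u` correct on all nodes of index `≥ N + 1 - e`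
  have hbuild : ∀ e : ℕ, ∃ u : Fin (N + 1) → ℝ, ∀ g : Fin (N + 1), N + 1 - e ≤ (g : ℕ) →
      u g = σ g + ∑ i ∈ univ.filter (fun i => par i = g), u i.succ := by
    intro e
    induction e with
    | zero => exact ⟨fun _ => 0, fun g hg => absurd g.isLt (not_lt.2 (by simpa using hg))⟩
    | succ e ih =>
      obtain ⟨u, hu⟩ := ih
      refine ⟨fun g => if (g : ℕ) = N - e then σ g + ∑ i ∈ univ.filter (fun i => par i = g), u i.succ
        else u g, fun g hg => ?_⟩
      have hchild : ∀ i, par i = g → ((i.succ : Fin (N + 1)) : ℕ) ≠ N - e := by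
        intro i hi
        have h1 : (g : ℕ) ≤ i := by rw [← hi]; exact hpar i
        rw [Fin.val_succ]
        omega
      have hsum : ∀ g' : Fin (N + 1), (N - e : ℕ) ≤ g' →
          (∑ i ∈ univ.filter (fun i => par i = g'),
            (if ((i.succ : Fin (N + 1)) : ℕ) = N - e then
              σ i.succ + ∑ i' ∈ univ.filter (fun i' => par i' = i.succ), u i'.succ else u i.succ)) =
          ∑ i ∈ univ.filter (fun i => par i = g'), u i.succ := by
        intro g' hg'
        refine sum_congr rfl fun i hi => ?_
        rw [mem_filter] at hi
        have h1 : (g' : ℕ) ≤ i := by rw [← hi.2]; exact hpar i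
        rw [if_neg (by rw [Fin.val_succ]; omega)]
      beta_reduce
      by_cases h : (g : ℕ) = N - e
      · rw [if_pos h, hsum g h.ge]
      · rw [if_neg h, hsum g (by omega)]
        exact hu g (by omega)
  obtain ⟨u, hu⟩ := hbuild (N + 1)
  have hrec : ∀ g, u g = σ g + ∑ i ∈ univ.filter (fun i => par i = g), u i.succ :=
    fun g => hu g (by omega)
  -- nonnegativity, by downward strong induction on the index
  have hnonneg : ∀ d : ℕ, ∀ g : Fin (N + 1), N - d ≤ (g : ℕ) → 0 ≤ u g := by
    intro d
    induction d with
    | zero =>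
      intro g hg
      rw [hrec g]
      refine add_nonneg (hσ0 g) (sum_nonneg fun i hi => ?_)
      rw [mem_filter] at hi
      have h1 : (g : ℕ) ≤ i := by rw [← hi.2]; exact hpar i
      have h2 := i.isLt
      omega
    | succ d ih =>
      intro g hg
      rw [hrec g]
      refine add_nonneg (hσ0 g) (sum_nonneg fun i hi => ih _ ?_)
      rw [mem_filter] at hi
      have h1 : (g : ℕ) ≤ i := by rw [← hi.2]; exact hpar i
      rw [Fin.val_succ]
      omega
  have hu0 : ∀ g, 0 ≤ u g := fun g => hnonneg N g (by omega)
  -- the root weight is `1` (double counting)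
  have hroot : u 0 = 1 := by
    have h1 : ∑ g, u g = ∑ g, σ g + ∑ g, ∑ i ∈ univ.filter (fun i => par i = g), u i.succ := by
      rw [← sum_add_distrib]
      exact sum_congr rfl fun g _ => hrec g
    rw [sum_fiberwise univ par (fun i => u i.succ), hσ1, Fin.sum_univ_succ] at h1
    linarith
  -- `u ≤ 1`, by upward strong induction on the index: `u (child) ≤ u (parent) ≤ 1`
  have hchild_le : ∀ i, u i.succ ≤ u (par i) := by
    intro i
    rw [hrec (par i)]
    have h1 : u i.succ ≤ ∑ j ∈ univ.filter (fun j => par j = par i), u j.succ :=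
      single_le_sum (s := univ.filter (fun j => par j = par i)) (f := fun j => u (Fin.succ j))
        (fun j _ => hu0 (Fin.succ j)) (mem_filter.2 ⟨mem_univ i, rfl⟩)
    linarith [hσ0 (par i)]
  have hle1 : ∀ d : ℕ, ∀ g : Fin (N + 1), (g : ℕ) ≤ d → u g ≤ 1 := by
    intro d
    induction d with
    | zero =>
      intro g hg
      have : g = 0 := Fin.ext (by simpa using hg)
      rw [this, hroot]
    | succ d ih =>
      intro g hg
      induction g using Fin.cases with
      | zero => rw [hroot]
      | succ i =>
        refine (hchild_le i).trans (ih _ ?_)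
        have h1 := hpar i
        rw [Fin.val_succ] at hg
        omega
  exact ⟨u, hrec, hu0, fun g => hle1 N g (Nat.lt_succ_iff.1 g.isLt), hroot⟩

end Summit.Ventures.Crystal3D.Theorems
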